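import Summits.QuantumFields.YangMills.Theorems.ColdStartUniversalityLatticeLangevinWilsonExplicitGap
import Summits.QuantumFields.YangMills.Theorems.ColdStartUniversalityLatticeLangevinCasimirTwo
import Summits.QuantumFields.YangMills.Theorems.ColdStartUniversalityLatticeLangevinLatitudeAlgebra
import Literature.MathematicalPhysics.QuantumFieldTheory.Balaban1983to89.T3CentreSymmetry
import HarnessLib

/-!
# Route `ColdStartUniversality` (fixed-cut-off `L²(μ_{β'})` package): the spectral gap of the SZZ dynamics NEVER EXCEEDS `3/2` —
# gauge modes are undamped at every coupling (`L ≥ 2`)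

Helper file (seat `ym-line-csu-p1`, g19; `--supports stmt-QuantumFields-27363`).  Companion upper bound to the explicit lower bound
`λ(L,β') = (3/2)e^{−4|β'|#𝒫}` of `…WilsonExplicitGap`: for the SU(2) lattice Langevin dynamics on `(ℤ/L)³`, `L ≥ 2`, at ANY coupling
`β'`, every constant `λ` in the generator-form Poincaré inequality `λ Var_{μ_{β'}}(F) ≤ −∫ (F − μF) 𝓛_{β'}f dμ_{β'}` on `C³` cylinders
satisfies `λ ≤ 3/2`, and so does every `L²(μ_{β'})` decay rate valid for all continuous observables.  The witnesses are the eight real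
coordinates `F_a(V) = coord_a(V_{e})` of ONE link (gauge-VARIANT observables): by linearity `𝓛_{β'}F_a = coord_a(b_{β'}(V)_e)` (drift
only), and summing over the orthonormal coordinate basis,
`Σ_a −∫ (F_a − μF_a) 𝓛F_a dμ = −∫ ⟨Q_e, (X_{β'}(Q) + C) Q_e⟩_HS dμ = 3` (`X ∈ 𝔰𝔲(2)` skew ⇒ `⟨Q, XQ⟩ = 0`; Casimir `C = −3/2`;
`‖Q_e‖² = 2`; the means `μF_a` vanish by gauge invariance at the source of `e` with the centre element `−1`, which needs
`x + e_μ ≠ x`, i.e. `L ≥ 2`), while `Σ_a Var(F_a) = ∫‖Q_e‖² dμ = 2`.  Hence `2λ ≤ 3`.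

* `sum_coord_mul_coord_eq_hsForm` — `Σ_a coord_a(X) coord_a(Y) = ⟨X, Y⟩_HS = Re tr(XYᴴ)`;
* `hsForm_self_mul_of_mem_lieAlg` — `⟨Q, XQ⟩ = 0` for unitary `Q` and `X ∈ 𝔰𝔲(2)`; `hsForm_self_drift` — `⟨Q_e, b_{β'}(Q)_e⟩ = −3`;
* `gaugeTransform_update_apply`, `integral_coord_link_eq_zero` — single-link coordinate means vanish under `μ_{β'}` (`L ≥ 2`);
* `generator_coord` — the coordinate generator of a coordinate function is the drift coordinate;
* ★★ `generatorPoincare_const_le_three_halves` — `λ ≤ 3/2` for every generator-form Poincaré constant of `μ_{β'}`, every `β'`;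
* ★★ `decayRate_le_three_halves` — `λ ≤ 3/2` for every `L²(μ_{β'})` decay rate (g18's converse `generatorPoincare_of_integral_sq_…`);
  with `wilson_spectralGap_explicit`: the optimal rate `λ_opt(L,β') ∈ [(3/2)e^{−4|β'|#𝒫}, 3/2]`, `= 3/2` at `β' = 0`.

THEOREMS ONLY, no definition, no sorry.  HONEST FRAMING: RECORD-rung R3 plumbing at FIXED cut-off; a statement about GAUGE modes
(lattice rate `≤ 3/2` = physical rate `≤ 3/(2ε_K)`, no obstruction to the K-uniform physical gap (H1)); nothing K-uniform is proved; no
crux, rung or summit statement is proved; the Yang–Mills mass gap is NOT proved.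
-/

set_option autoImplicit false

noncomputable section

namespace Summit.QuantumFields.YangMills.Theorems.ColdStartUniversality

open MeasureTheory ProbabilityTheory Finset Filter Set Topology
open scoped BigOperators NNReal ENNReal ComplexConjugate
open Literature.Probability.Process Literature.MathematicalPhysics.QuantumFieldTheory
open Literature.MathematicalPhysics.QuantumLattice (fundamentalRep fundamentalLatticeRep continuous_fundamentalRep)
open Literature.MathematicalPhysics.QuantumFieldTheory.Balaban1983to89.T3ContinuumYM3Torus (negOne₂)

variable {L : ℕ} [NeZero L]

/-! ## Linear algebra: coordinates, the skew part of the drift, the Casimir -/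

/-- `Σ_a coord_a(X)·coord_a(Y) = Re tr(X Yᴴ)` over the eight real coordinates `a = (i, j, re/im)` of a `2 × 2` complex matrix.
[folklore] -/
theorem sum_coord_mul_coord_eq_hsForm (X Y : Matrix (Fin 2) (Fin 2) ℂ) :
    ∑ a : Fin 2 × Fin 2 × Bool, (fun z : ℂ => if a.2.2 then z.im else z.re) (X a.1 a.2.1) *
        (fun z : ℂ => if a.2.2 then z.im else z.re) (Y a.1 a.2.1) = hsForm 2 X Y := by
  rw [hsForm_eq_sum_entries, Fintype.sum_prod_type]
  refine Finset.sum_congr rfl fun i _ => ?_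
  rw [Fintype.sum_prod_type]
  refine Finset.sum_congr rfl fun j _ => ?_
  rw [Fintype.sum_bool]
  simp only [if_true, Bool.false_eq_true, if_false, Complex.mul_re, Complex.conj_re, Complex.conj_im]
  ring

/-- `⟨Q, XQ⟩_HS = 0` for `Q ∈ SU(2)` (unitary) and `X` in the embedded Lie algebra `𝔰𝔲(2)` (skew-Hermitian, traceless):
`Re tr(Q Qᴴ Xᴴ) = Re tr(Xᴴ) = 0`. [folklore] -/
theorem hsForm_self_mul_of_mem_lieAlg (u : Matrix.specialUnitaryGroup (Fin 2) ℂ)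
    {X : Matrix (Fin (fundamentalLatticeRep 2).N) (Fin (fundamentalLatticeRep 2).N) ℂ} (hX : X ∈ (fundamentalLatticeRep 2).lieAlg) :
    hsForm (fundamentalLatticeRep 2).N ((fundamentalLatticeRep 2).ρ u) (X * (fundamentalLatticeRep 2).ρ u) = 0 := by
  have hu : (fundamentalLatticeRep 2).ρ u * star ((fundamentalLatticeRep 2).ρ u) = 1 :=
    Matrix.mem_unitaryGroup_iff.1 ((fundamentalLatticeRep 2).mem_unitary u)
  have htr : X.trace = 0 := trace_eq_zero_of_mem_lieAlg_two hX
  rw [hsForm_apply, Matrix.conjTranspose_mul, ← Matrix.mul_assoc, ← Matrix.star_eq_conjTranspose, hu, Matrix.one_mul,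
    Matrix.trace_conjTranspose, htr, star_zero, Complex.zero_re]

omit [NeZero L] in
/-- **`⟨Q_e, b_{β'}(Q)_e⟩_HS = −3`** for the SZZ drift `b_{β'}(Q)_e = (X_{β'}(Q)_e + C) Q_e` at a group point (`X ∈ 𝔰𝔲(2)` contributes `0`,
the Casimir `C = −3/2` contributes `−(3/2)‖Q_e‖² = −3`). [cite: ShenZhuZhu2022, §2 "Brownian motions" (c_{su(N)} = -(N²-1)/N)] -/
theorem hsForm_self_drift (β' : ℝ) (V : GaugeConfig 3 L (Matrix.specialUnitaryGroup (Fin 2) ℂ)) (e : Edge 3 L) :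
    hsForm (fundamentalLatticeRep 2).N ((fundamentalLatticeRep 2).ρ (V e))
      ((latticeLangevinDynamics (fundamentalLatticeRep 2) β').drift (matrixConfig (fundamentalLatticeRep 2).ρ V) e) = -3 := by
  rw [latticeLangevinDynamics_drift, Matrix.add_mul, map_add]
  have hQ : matrixConfig (fundamentalLatticeRep 2).ρ V e = (fundamentalLatticeRep 2).ρ (V e) := rfl
  rw [hQ, hsForm_self_mul_of_mem_lieAlg (V e) ((fundamentalLatticeRep 2).driftLie_mem_lieAlg β' _ e),
    hsForm_casimir_two_mul, zero_add]
  have h2 : hsForm (fundamentalLatticeRep 2).N ((fundamentalLatticeRep 2).ρ (V e)) ((fundamentalLatticeRep 2).ρ (V e)) = 2 :=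
    hsForm_self_fundamentalRep (V e)
  rw [h2]
  norm_num

/-! ## Single-link coordinate means vanish (gauge invariance with the centre element; needs `x + e_μ ≠ x`) -/

omit [NeZero L] in
/-- The gauge transformation `γ = 1` except `γ(x) = g` at the source `x` of the link `e = (x, μ)` multiplies `U_e` by `g` on the left,
provided `x + e_μ ≠ x` (torus side `L ≥ 2`). [folklore] -/
theorem gaugeTransform_update_apply {e : Edge 3 L} (hshift : e.1.shift e.2 ≠ e.1) (g : Matrix.specialUnitaryGroup (Fin 2) ℂ)
    (U : GaugeConfig 3 L (Matrix.specialUnitaryGroup (Fin 2) ℂ)) :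
    gaugeTransform (Function.update (fun _ => (1 : Matrix.specialUnitaryGroup (Fin 2) ℂ)) e.1 g) U e = g * U e := by
  classical
  unfold gaugeTransform
  rw [Function.update_self, Function.update_of_ne hshift, inv_one, mul_one]

omit [NeZero L] in
/-- On a torus of side `L ≥ 2` every link has distinct endpoints: `x + e_μ ≠ x`. [folklore] -/
theorem shift_ne_self (hL : 2 ≤ L) (e : Edge 3 L) : e.1.shift e.2 ≠ e.1 := by
  intro h
  have h1 : (Pi.single e.2 (1 : ZMod L) : Fin 3 → ZMod L) = 0 := by
    have := congr_arg (fun y => y - e.1) h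
    simpa [Site.shift] using this
  have h2 : (1 : ZMod L) = 0 := by simpa using congr_fun h1 e.2
  have h3 : (L : ℤ) ∣ 1 := by
    have := (ZMod.intCast_zmod_eq_zero_iff_dvd 1 L).1 (by exact_mod_cast h2)
    exact_mod_cast this
  have h4 : (L : ℤ) ≤ 1 := Int.le_of_dvd one_pos h3
  omega

/-- **Single-link coordinate means vanish under the Wilson measure** (`L ≥ 2`, every `β'`): `∫ coord_a(ρ(V_e)) dμ_{β'} = 0` — the
measure is invariant under the gauge transformation by the centre element `−1` at the source of `e`, which flips the sign of `ρ(V_e)`.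
[folklore] -/
theorem integral_coord_link_eq_zero (β' : ℝ) {e : Edge 3 L} (hshift : e.1.shift e.2 ≠ e.1) (a : Fin 2 × Fin 2 × Bool) :
    ∫ V, (fun z : ℂ => if a.2.2 then z.im else z.re)
        ((fundamentalRep (Fin 2) (V e) : Matrix (Fin 2) (Fin 2) ℂ) a.1 a.2.1)
      ∂(wilsonMeasure (d := 3) (L := L) (fundamentalRep (Fin 2)) β') = 0 := by
  classical
  haveI := secondCountableTopology_su2
  haveI := borelSpace_config L
  set μ : Measure (GaugeConfig 3 L (Matrix.specialUnitaryGroup (Fin 2) ℂ)) :=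
    wilsonMeasure (d := 3) (L := L) (fundamentalRep (Fin 2)) β' with hμ
  set γ : Site 3 L → Matrix.specialUnitaryGroup (Fin 2) ℂ :=
    Function.update (fun _ => (1 : Matrix.specialUnitaryGroup (Fin 2) ℂ)) e.1 negOne₂ with hγ
  set crd : GaugeConfig 3 L (Matrix.specialUnitaryGroup (Fin 2) ℂ) → ℝ := fun V =>
    (fun z : ℂ => if a.2.2 then z.im else z.re) ((fundamentalRep (Fin 2) (V e) : Matrix (Fin 2) (Fin 2) ℂ) a.1 a.2.1) with hcrd
  have hcont : Continuous crd := by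
    have hc : Continuous fun V : GaugeConfig 3 L (Matrix.specialUnitaryGroup (Fin 2) ℂ) =>
        ((fundamentalRep (Fin 2) (V e) : Matrix (Fin 2) (Fin 2) ℂ) a.1 a.2.1) :=
      (continuous_apply a.2.1).comp ((continuous_apply a.1).comp ((continuous_fundamentalRep (n := Fin 2)).comp (continuous_apply e)))
    rcases a with ⟨i, j, b⟩
    cases b
    · exact Complex.continuous_re.comp hc
    · exact Complex.continuous_im.comp hc
  have hmap : μ.map (gaugeTransform γ) = μ :=
    wilsonMeasure_map_gaugeTransform_holds (d := 3) (L := L) (fundamentalRep (Fin 2)) β' γ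
  have hT : Measurable (gaugeTransform γ : GaugeConfig 3 L (Matrix.specialUnitaryGroup (Fin 2) ℂ) → _) := by
    have hc : Continuous (gaugeTransform γ : GaugeConfig 3 L (Matrix.specialUnitaryGroup (Fin 2) ℂ) → _) :=
      continuous_pi fun e' => (continuous_const.mul (continuous_apply e')).mul continuous_const
    exact hc.measurable
  -- `∫ crd dμ = ∫ crd ∘ (gauge flip) dμ = −∫ crd dμ`
  have hflip : ∀ V, crd (gaugeTransform γ V) = -crd V := by
    intro V
    simp only [hcrd]
    rw [gaugeTransform_update_apply hshift negOne₂ V, map_mul]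
    have hneg : (fundamentalRep (Fin 2) negOne₂ : Matrix (Fin 2) (Fin 2) ℂ) = -1 := rfl
    rw [hneg, neg_mul, one_mul, Matrix.neg_apply]
    rcases a with ⟨i, j, b⟩
    cases b <;> simp
  have h1 : ∫ V, crd V ∂μ = ∫ V, crd (gaugeTransform γ V) ∂μ := by
    conv_lhs => rw [← hmap]
    exact integral_map hT.aemeasurable hcont.aestronglyMeasurable
  simp_rw [hflip, integral_neg] at h1
  show ∫ V, crd V ∂μ = 0
  linarith

/-! ## The coordinate generator of a coordinate function -/

omit [NeZero L] in
/-- `D(y ↦ y_q)(z)·v = v_q`. [folklore] -/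
theorem fderiv_coord_apply (q : Edge 3 L × Fin 2 × Fin 2 × Bool) (z v : Edge 3 L × Fin 2 × Fin 2 × Bool → ℝ) :
    fderiv ℝ (fun y : Edge 3 L × Fin 2 × Fin 2 × Bool → ℝ => y q) z v = v q := by
  rw [(hasFDerivAt_apply q z).fderiv, ContinuousLinearMap.proj_apply]

/-- **The SZZ coordinate generator of the coordinate function `y ↦ y_{(e,a)}` is the drift coordinate `coord_a(b_{β'}(Q)_e)`** (a linear
function has no second-order term). [folklore] -/
theorem generator_coord (β' : ℝ) (e : Edge 3 L) (a : Fin 2 × Fin 2 × Bool)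
    (V : GaugeConfig 3 L (Matrix.specialUnitaryGroup (Fin 2) ℂ)) :
    let coords : GaugeConfig 3 L (Matrix.specialUnitaryGroup (Fin 2) ℂ) → (Edge 3 L × Fin 2 × Fin 2 × Bool → ℝ) :=
      fun V q => (fun z : ℂ => if q.2.2.2 then z.im else z.re)
        ((fundamentalRep (Fin 2) (V q.1) : Matrix (Fin 2) (Fin 2) ℂ) q.2.1 q.2.2.1)
    (∑ i : Edge 3 L × Fin 2 × Fin 2 × Bool,
        fderiv ℝ (fun y : Edge 3 L × Fin 2 × Fin 2 × Bool → ℝ => y (e, a)) (coords V) (Pi.single i 1) *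
          (fun z : ℂ => if i.2.2.2 then z.im else z.re)
            ((latticeLangevinDynamics (fundamentalLatticeRep 2) β').drift
              (matrixConfig (fundamentalRep (Fin 2)) V) i.1 i.2.1 i.2.2.1) +
      1 / 2 * ∑ i : Edge 3 L × Fin 2 × Fin 2 × Bool, ∑ j : Edge 3 L × Fin 2 × Fin 2 × Bool,
        fderiv ℝ (fun z => fderiv ℝ (fun y : Edge 3 L × Fin 2 × Fin 2 × Bool → ℝ => y (e, a)) z (Pi.single i 1))
            (coords V) (Pi.single j 1) *
          ∑ n : Edge 3 L × NoiseIdx 2,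
            (if n.1 = i.1 then (fun z : ℂ => if i.2.2.2 then z.im else z.re)
              ((latticeLangevinDynamics (fundamentalLatticeRep 2) β').noise
                (matrixConfig (fundamentalRep (Fin 2)) V) i.1 n.2 i.2.1 i.2.2.1) else 0) *
            (if n.1 = j.1 then (fun z : ℂ => if j.2.2.2 then z.im else z.re)
              ((latticeLangevinDynamics (fundamentalLatticeRep 2) β').noise
                (matrixConfig (fundamentalRep (Fin 2)) V) j.1 n.2 j.2.1 j.2.2.1) else 0)) =
      (fun z : ℂ => if a.2.2 then z.im else z.re)
        ((latticeLangevinDynamics (fundamentalLatticeRep 2) β').drift (matrixConfig (fundamentalRep (Fin 2)) V) e a.1 a.2.1) := by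
  intro coords
  classical
  -- second-order term: the first derivative is constant in `z`
  have h2 : ∀ i j : Edge 3 L × Fin 2 × Fin 2 × Bool,
      fderiv ℝ (fun z => fderiv ℝ (fun y : Edge 3 L × Fin 2 × Fin 2 × Bool → ℝ => y (e, a)) z (Pi.single i 1))
        (coords V) (Pi.single j 1) = 0 := by
    intro i j
    have hc : (fun z : Edge 3 L × Fin 2 × Fin 2 × Bool → ℝ =>
        fderiv ℝ (fun y : Edge 3 L × Fin 2 × Fin 2 × Bool → ℝ => y (e, a)) z (Pi.single i 1)) =
        fun _ => (Pi.single i (1 : ℝ) : Edge 3 L × Fin 2 × Fin 2 × Bool → ℝ) (e, a) :=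
      funext fun z => fderiv_coord_apply (L := L) (e, a) z _
    rw [hc, fderiv_const_apply]; simp
  simp_rw [h2, zero_mul, Finset.sum_const_zero, mul_zero, add_zero, fderiv_coord_apply, Pi.single_apply]
  simp_rw [boole_mul]
  rw [Finset.sum_ite_eq, if_pos (Finset.mem_univ _)]

/-! ## ★★ The gap never exceeds `3/2` -/

/-- ★★ **Every generator-form Poincaré constant of `μ_{β'}` is `≤ 3/2`** (`L ≥ 2`, every `β'`).  If
`λ Var_{μ_{β'}}(F) ≤ −∫ (F − μF) 𝓛_{β'}f dμ_{β'}` for every `C³` function `f` of the link coordinates, then `λ ≤ 3/2`: tested on the eight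
coordinate functions of one link, `Σ_a Var(F_a) = 2` and `Σ_a 𝓔(F_a) = −∫⟨Q_e, b_{β'}(Q)_e⟩ dμ = 3`.  Sharp at `β' = 0`
(`haar_generatorPoincare`). [folklore] -/
theorem generatorPoincare_const_le_three_halves (L : ℕ) [NeZero L] (hL : 2 ≤ L) (β' : ℝ) {lam : ℝ}
    (hPgen : ∀ (f : (Edge 3 L × Fin 2 × Fin 2 × Bool → ℝ) → ℝ), ContDiff ℝ 3 f →
        let coords : GaugeConfig 3 L (Matrix.specialUnitaryGroup (Fin 2) ℂ) → (Edge 3 L × Fin 2 × Fin 2 × Bool → ℝ) :=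
          fun V q => (fun z : ℂ => if q.2.2.2 then z.im else z.re)
            ((fundamentalRep (Fin 2) (V q.1) : Matrix (Fin 2) (Fin 2) ℂ) q.2.1 q.2.2.1)
        let gen : GaugeConfig 3 L (Matrix.specialUnitaryGroup (Fin 2) ℂ) → ℝ := fun V =>
          (∑ i : Edge 3 L × Fin 2 × Fin 2 × Bool, fderiv ℝ f (coords V) (Pi.single i 1) *
              (fun z : ℂ => if i.2.2.2 then z.im else z.re)
                ((latticeLangevinDynamics (fundamentalLatticeRep 2) β').drift
                  (matrixConfig (fundamentalRep (Fin 2)) V) i.1 i.2.1 i.2.2.1) +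
          1 / 2 * ∑ i : Edge 3 L × Fin 2 × Fin 2 × Bool, ∑ j : Edge 3 L × Fin 2 × Fin 2 × Bool,
            fderiv ℝ (fun z => fderiv ℝ f z (Pi.single i 1)) (coords V) (Pi.single j 1) *
              ∑ n : Edge 3 L × NoiseIdx 2,
                (if n.1 = i.1 then (fun z : ℂ => if i.2.2.2 then z.im else z.re)
                  ((latticeLangevinDynamics (fundamentalLatticeRep 2) β').noise
                    (matrixConfig (fundamentalRep (Fin 2)) V) i.1 n.2 i.2.1 i.2.2.1) else 0) *
                (if n.1 = j.1 then (fun z : ℂ => if j.2.2.2 then z.im else z.re)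
                  ((latticeLangevinDynamics (fundamentalLatticeRep 2) β').noise
                    (matrixConfig (fundamentalRep (Fin 2)) V) j.1 n.2 j.2.1 j.2.2.1) else 0))
        lam * ∫ V, (f (coords V) - ∫ V', f (coords V') ∂(wilsonMeasure (d := 3) (L := L) (fundamentalRep (Fin 2)) β')) ^ 2
            ∂(wilsonMeasure (d := 3) (L := L) (fundamentalRep (Fin 2)) β') ≤
          -∫ V, (f (coords V) - ∫ V', f (coords V') ∂(wilsonMeasure (d := 3) (L := L) (fundamentalRep (Fin 2)) β')) *
            gen V ∂(wilsonMeasure (d := 3) (L := L) (fundamentalRep (Fin 2)) β')) :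
    lam ≤ 3 / 2 := by
  classical
  haveI := secondCountableTopology_su2
  haveI := borelSpace_config L
  set μ : Measure (GaugeConfig 3 L (Matrix.specialUnitaryGroup (Fin 2) ℂ)) :=
    wilsonMeasure (d := 3) (L := L) (fundamentalRep (Fin 2)) β' with hμ
  haveI : IsProbabilityMeasure μ :=
    isProbabilityMeasure_wilsonMeasure (d := 3) (L := L) (fundamentalRep (Fin 2)) (continuous_fundamentalRep (Fin 2)) β'
  -- a link with distinct endpoints
  obtain ⟨e⟩ : Nonempty (Edge 3 L) := inferInstance
  have hshift : e.1.shift e.2 ≠ e.1 := shift_ne_self hL e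
  -- the eight coordinate observables and their drift coordinates
  set F : (Fin 2 × Fin 2 × Bool) → GaugeConfig 3 L (Matrix.specialUnitaryGroup (Fin 2) ℂ) → ℝ := fun a V =>
    (fun z : ℂ => if a.2.2 then z.im else z.re) ((fundamentalRep (Fin 2) (V e) : Matrix (Fin 2) (Fin 2) ℂ) a.1 a.2.1) with hF
  set B : (Fin 2 × Fin 2 × Bool) → GaugeConfig 3 L (Matrix.specialUnitaryGroup (Fin 2) ℂ) → ℝ := fun a V =>
    (fun z : ℂ => if a.2.2 then z.im else z.re)
      ((latticeLangevinDynamics (fundamentalLatticeRep 2) β').drift (matrixConfig (fundamentalRep (Fin 2)) V) e a.1 a.2.1) with hB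
  have hFc : ∀ a, Continuous (F a) := by
    intro a
    have hc : Continuous fun V : GaugeConfig 3 L (Matrix.specialUnitaryGroup (Fin 2) ℂ) =>
        ((fundamentalRep (Fin 2) (V e) : Matrix (Fin 2) (Fin 2) ℂ) a.1 a.2.1) :=
      (continuous_apply a.2.1).comp ((continuous_apply a.1).comp ((continuous_fundamentalRep (n := Fin 2)).comp (continuous_apply e)))
    rcases a with ⟨i, j, b⟩
    cases b
    · exact Complex.continuous_re.comp hc
    · exact Complex.continuous_im.comp hc
  have hBc : ∀ a, Continuous (B a) := by
    intro a
    have hc : Continuous fun V : GaugeConfig 3 L (Matrix.specialUnitaryGroup (Fin 2) ℂ) =>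
        (latticeLangevinDynamics (fundamentalLatticeRep 2) β').drift (matrixConfig (fundamentalRep (Fin 2)) V) e a.1 a.2.1 :=
      (continuous_apply a.2.1).comp ((continuous_apply a.1).comp (continuous_drift_matrixConfig β' e))
    rcases a with ⟨i, j, b⟩
    cases b
    · exact Complex.continuous_re.comp hc
    · exact Complex.continuous_im.comp hc
  -- means vanish
  have hmean : ∀ a, ∫ V, F a V ∂μ = 0 := fun a => integral_coord_link_eq_zero (L := L) β' hshift a
  -- the Poincaré inequality on each coordinate function: `λ ∫ F_a² ≤ −∫ F_a B_a`
  have hP : ∀ a, lam * ∫ V, (F a V) ^ 2 ∂μ ≤ -∫ V, F a V * B a V ∂μ := by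
    intro a
    have h := hPgen (fun y => y (e, a)) (contDiff_apply ℝ ℝ (e, a))
    dsimp only at h
    simp_rw [generator_coord β' e a] at h
    have hm : ∫ V', F a V' ∂μ = 0 := hmean a
    simp only [hF] at hm
    rw [hm] at h
    simpa [hF, hB] using h
  -- sum over the eight coordinates
  have hsumE : ∑ a, ∫ V, F a V * B a V ∂μ = -3 := by
    rw [← integral_finsetSum _ fun a _ =>
      integrable_of_continuous_of_compactSpace (f := fun V => F a V * B a V) ((hFc a).mul (hBc a)) μ]
    have e3 : ∀ V, ∑ a, F a V * B a V = -3 := fun V => by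
      simp only [hF, hB]
      rw [sum_coord_mul_coord_eq_hsForm]
      exact hsForm_self_drift β' V e
    simp_rw [e3]
    rw [integral_const, probReal_univ, one_smul]
  have hsumV : ∑ a, ∫ V, (F a V) ^ 2 ∂μ = 2 := by
    rw [← integral_finsetSum _ fun a _ =>
      integrable_of_continuous_of_compactSpace (f := fun V => (F a V) ^ 2) ((hFc a).pow 2) μ]
    have e2 : ∀ V, ∑ a, (F a V) ^ 2 = 2 := fun V => by
      simp only [hF, sq]
      rw [sum_coord_mul_coord_eq_hsForm]
      exact hsForm_self_fundamentalRep (V e)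
    simp_rw [e2]
    rw [integral_const, probReal_univ, one_smul]
  have hsum : lam * 2 ≤ 3 := by
    calc lam * 2 = ∑ a, lam * ∫ V, (F a V) ^ 2 ∂μ := by rw [← Finset.mul_sum, hsumV]
      _ ≤ ∑ a, -∫ V, F a V * B a V ∂μ := Finset.sum_le_sum fun a _ => hP a
      _ = 3 := by rw [Finset.sum_neg_distrib, hsumE]; norm_num
  linarith

/-- ★★ **Every `L²(μ_{β'})` decay rate of the SZZ dynamics is `≤ 3/2`** (`L ≥ 2`, every `β'`): if a realising kernel family satisfies
`∫ (κ_t G − μG)² dμ_{β'} ≤ e^{−2λt} Var_{μ_{β'}}(G)` for every continuous `G` and every `t`, then `λ ≤ 3/2` (g18's converse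
`generatorPoincare_of_integral_sq_transition_sub_le_exp` + `generatorPoincare_const_le_three_halves`).  With `wilson_spectralGap_explicit`:
the optimal rate lies in `[(3/2)e^{−4|β'|#𝒫}, 3/2]`, and equals `3/2` at `β' = 0`. [cite: BakryGentilLedoux2014, Thm 4.2.5] -/
theorem decayRate_le_three_halves (L : ℕ) [NeZero L] (hL : 2 ≤ L) (β' : ℝ)
    (κ : ℝ≥0 → Kernel (GaugeConfig 3 L (Matrix.specialUnitaryGroup (Fin 2) ℂ))
      (GaugeConfig 3 L (Matrix.specialUnitaryGroup (Fin 2) ℂ))) [∀ t, IsMarkovKernel (κ t)]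
    (hreal : ∀ (t : ℝ≥0) (x : GaugeConfig 3 L (Matrix.specialUnitaryGroup (Fin 2) ℂ))
        (Ω : Type) [MeasurableSpace Ω] (P : Measure Ω) [IsProbabilityMeasure P]
        (W : ℝ≥0 → Ω → (Edge 3 L × NoiseIdx 2 → ℝ)) (hW : IsFlatBrownian W P)
        (U : ℝ≥0 → Ω → GaugeConfig 3 L (Matrix.specialUnitaryGroup (Fin 2) ℂ)),
        (∀ ω, U 0 ω = x) →
        (latticeLangevinDynamics (fundamentalLatticeRep 2) β').IsSolution (fundamentalRep (Fin 2))
          hW.natFiltration P W U →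
        κ t x = P.map (U t))
    {lam : ℝ}
    (hdecay : ∀ (G : GaugeConfig 3 L (Matrix.specialUnitaryGroup (Fin 2) ℂ) → ℝ), Continuous G → ∀ t : ℝ≥0,
      ∫ x, ((∫ y, G y ∂(κ t x)) - ∫ z, G z ∂(wilsonMeasure (d := 3) (L := L) (fundamentalRep (Fin 2)) β')) ^ 2
          ∂(wilsonMeasure (d := 3) (L := L) (fundamentalRep (Fin 2)) β') ≤
        Real.exp (-2 * lam * t) *
          ∫ x, (G x - ∫ z, G z ∂(wilsonMeasure (d := 3) (L := L) (fundamentalRep (Fin 2)) β')) ^ 2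
            ∂(wilsonMeasure (d := 3) (L := L) (fundamentalRep (Fin 2)) β')) :
    lam ≤ 3 / 2 :=
  generatorPoincare_const_le_three_halves L hL β'
    (fun f hf => generatorPoincare_of_integral_sq_transition_sub_le_exp L β' κ hreal hdecay f hf)

end Summit.QuantumFields.YangMills.Theorems.ColdStartUniversality

end
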